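import Summits.CriticalPhenomena.PercolationContinuityZ3.Theorems.PercNearOneGluingNoHeavyPcintMeanMemSound
import HarnessLib

/-!
# CriticalPhenomena/PercolationContinuityZ3 — Theorems/PercNearOneGluingNoHeavyPcintSaturationLaw.lean:
# STRUCTURE conjecture **C1b** of the pcint lane (finite-memory B3m bookkeeping SATURATES STRICTLY BELOW `p_c`), TYPED

HONEST FRAMING: this file types a conjecture about the REACH of the lane's own certificate method; it is NOT used by any
certified `p_c` interval.  Coordinator STANDING RULE «NUMERICS ⇒ STRUCTURE ⇒ CONJECTURE» (2026-08-22), item (5); statement of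
record run/shared/lean/prim/pcint/STRUCTURE.md v0.5 §2 (C1′, consequence C1b) and §5 (C1 draft typing, gen 11; referee gen-79
annotation (a): "the δ_τ clause for the lane rules (B3m …) is UNTYPED (no `pstar` in the tree)" — this file supplies it).

THE OBJECT.  The lane's bond certificates (`le_criticalProb_zd_of_meanMem_total`, `…PcintMeanMemSound`; kernel rows
`criticalProb_Z3_ge_02241`, `criticalProb_Z4_ge_015214`, …) prove `p ≤ p_c^bond(ℤ^d)` from a geometric bound on the totals of
the memory-`τ`, chord-cutoff-`kc` B3m automaton `bmeanMemAut τ kc p (1-p) s t m κ̄` with admissible constants.  `p ∈ B3mCertSet d τ kc`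
below is EXACTLY the hypothesis list of that theorem (existentially quantified constants), so that
`le_criticalProb_of_mem_B3mCertSet` is the theorem itself; `pstarB3m d τ kc := sSup {p certifiable}` is the cell's threshold
`p*_d(τ, kc)` (the engines' Perron root `ρ(p*) = 1` of the exact-rule matrix: larger admissible constants only raise weights, and
`ρ < 1 ⇔` geometric totals), and `pstarB3m_le_criticalProb` is its PROVED ceiling.  The CONJECTURE `saturationBelowCritical` (C1b)
says the ceiling is never approached: uniformly in `τ, kc` the certifiable `p` stay a fixed `η_d > 0` below `p_c^bond(ℤ^d)`.

EVIDENCE LEDGER (STRUCTURE.md §1–§3): best-kc thresholds p*_3(τ) = 0.22294 / 0.22416 / 0.22502 / 0.22565 / 0.22612 (τ = 10..18,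
three engines + kernel rows at τ = 12: 0.2241 two-implementation), increments obeying the MEMORY-TAIL LAW C1′ (`…PcintMemoryTailLaw`,
typed; pre-registered P1/P2/P3/P4/P5 HIT) with limit p*_3(∞) = 0.2294 ± 0.0007 against p_c^bond(ℤ³) ≈ 0.2488 (MC) — a gap of
≈ 0.019 = 8 % of p_c; d = 4/5/6: limits ≈ 0.1539 / 0.1161 / 0.0935 vs p_c ≈ 0.1601 / 0.1182 / 0.0942.  MECHANISM (§4, 'method space
closed at B3m'): an exact per-site telescoping beyond B3m needs the count of FORGOTTEN incidences and Harris forbids product bookings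
of edge-sharing decreasing events, so even τ = ∞ books only the single-site information ideal (≈ 0.2302 on ℤ³), itself < p_c.
Falsifier: a certified B3m row above p_c − η for every η (e.g. a d = 3 row above 0.235).  Written by prim-pcint-2 gen 14
(prover-prim-pcint-2-g14-0), 2026-08-23.
-/

noncomputable section

open Literature.Probability.Percolation Literature.Probability.LatticeModels

namespace Summit.CriticalPhenomena.PercolationContinuityZ3.Theorems.Pcint.Saturation

variable {d : ℕ}

/-- **The B3m-certifiable densities at memory `τ`, chord cutoff `kc` on `ℤ^d`**: the set of `p ∈ [0,1]` for which there are
admissible constants `s, t, t', m, κ̄` (the hypothesis list of `le_criticalProb_zd_of_meanMem_total`, verbatim) and `C, λ < 1` with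
`total n ∅ ≤ C λⁿ` for the B3m dangerous-set automaton.  Membership is what a kernel certificate row of the lane establishes.
[folklore] -/
def B3mCertSet (d τ kc : ℕ) : Set unitInterval := {p |
  kc + 4 ≤ τ ∧ 2 ≤ kc ∧
  ∃ (s tv t' mv κb C lam : ℝ) (hs0 : 0 < s) (ht0 : 0 < tv) (hm0 : 0 ≤ mv) (hκb0 : 0 ≤ κb),
    1 - (p : ℝ) ^ 2 ≤ s ^ 2 ∧ s ≤ 1 ∧ tv ≤ t' ∧ t' ≤ s ∧ (tv + t') / 2 ≤ mv ∧ mv ≤ s ∧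
    (1 - (p : ℝ)) * (1 + 2 * p) ≤ tv * (1 + p) ∧ (p : ℝ) ^ 2 ≤ (t' - tv) * (1 + p) ∧ 1 - (p : ℝ) ≤ s * tv ^ 2 ∧
    tv ≤ s ^ 2 ∧ (1 + s ^ 2) / 2 ≤ κb ∧ 0 ≤ lam ∧ lam < 1 ∧
    ∀ n, (bmeanMemAut τ kc p (1 - p) s tv mv κb p.2.1 (sub_nonneg.2 p.2.2) hs0.le ht0.le hm0 hκb0).total n
      (∅ : MState d) ≤ C * lam ^ n}

/-- **The certificate is sound (PROVED ceiling)**: a B3m-certifiable `p` is at most `p_c^bond(ℤ^d)` — this is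
`le_criticalProb_zd_of_meanMem_total` read through the definition. [folklore] -/
theorem le_criticalProb_of_mem_B3mCertSet [NeZero d] {τ kc : ℕ} {p : unitInterval} (h : p ∈ B3mCertSet d τ kc) :
    (p : ℝ) ≤ criticalProb (zdGraph d) 0 := by
  obtain ⟨hτ, hkc, s, tv, t', mv, κb, C, lam, hs0, ht0, hm0, hκb0, hps, hs1, htt, hts, hmv, hms, htp, hgap, hqt, hts2, hκb,
    hlam0, hlam1, htot⟩ := h
  exact le_criticalProb_zd_of_meanMem_total hτ hkc p hps hs0 hs1 ht0 htt hts hmv hms htp hgap hqt hts2 hκb hlam0 hlam1 hm0 htot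

/-- **Non-vacuity**: `p = 0` is certifiable (constants `s = t = t' = m = κ̄ = 1`, all weights vanish, `total n ∅ = [n = 0]`).
[folklore] -/
theorem zero_mem_B3mCertSet {τ kc : ℕ} (hτ : kc + 4 ≤ τ) (hkc : 2 ≤ kc) : (0 : unitInterval) ∈ B3mCertSet d τ kc := by
  refine ⟨hτ, hkc, 1, 1, 1, 1, 1, 1, 1 / 2, by norm_num, by norm_num, by norm_num, by norm_num, ?_⟩
  refine ⟨by norm_num, le_rfl, le_rfl, le_rfl, by norm_num, le_rfl, by norm_num, by norm_num, by norm_num, by norm_num,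
    by norm_num, by norm_num, by norm_num, fun n => ?_⟩
  cases n with
  | zero => rw [WAut.total_zero]; norm_num
  | succ n =>
    rw [WAut.total_succ, WAut.stepSum]
    refine (Finset.sum_eq_zero fun a _ => ?_).trans_le (by positivity)
    split
    · rfl
    · simp [bmeanMemAut]

/-- **`p*_d(τ, kc)`**, the B3m threshold of the lane at memory `τ` and chord cutoff `kc`: the supremum of the certifiable `p`
(`= 0` if nothing is certifiable, e.g. `τ < kc + 4`).  STRUCTURE.md §1: p*_3(τ) (best kc) = 0.22294, 0.22416, 0.22502, 0.22565,
0.22612 for τ = 10, …, 18. [folklore] -/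
def pstarB3m (d τ kc : ℕ) : ℝ := sSup {x : ℝ | ∃ p ∈ B3mCertSet d τ kc, (p : ℝ) = x}

/-- **PROVED ceiling**: `p*_d(τ, kc) ≤ p_c^bond(ℤ^d)` for every `τ, kc` (soundness of the certificates). [folklore] -/
theorem pstarB3m_le_criticalProb [NeZero d] (τ kc : ℕ) : pstarB3m d τ kc ≤ criticalProb (zdGraph d) 0 := by
  refine Real.sSup_le (fun x hx => ?_) (criticalProb_mem_Icc (zdGraph d) 0).1
  obtain ⟨p, hp, rfl⟩ := hx
  exact le_criticalProb_of_mem_B3mCertSet hp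

/-- `0 ≤ p*_d(τ, kc)`. [folklore] -/
theorem pstarB3m_nonneg (τ kc : ℕ) : 0 ≤ pstarB3m d τ kc := by
  refine Real.sSup_nonneg ?_
  rintro x ⟨p, -, rfl⟩
  exact p.2.1

/-- **C1b — SATURATION STRICTLY BELOW CRITICALITY (conjecture)**: for every `d ≥ 3` there is `η > 0` such that every
B3m-certifiable `p`, at ANY memory `τ` and chord cutoff `kc`, satisfies `p + η ≤ p_c^bond(ℤ^d)`; equivalently
`sup_{τ,kc} p*_d(τ,kc) < p_c^bond(ℤ^d)`: finite-memory chord bookkeeping never reaches the critical point.  Evidence: the measured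
thresholds follow the memory-tail law C1′ with limits 0.2294 ± 0.0007 (ℤ³; p_c ≈ 0.2488), ≈ 0.1539 / 0.1161 / 0.0935 (ℤ⁴/ℤ⁵/ℤ⁶;
p_c ≈ 0.1601 / 0.1182 / 0.0942); the τ = ∞ single-site-information ideal on ℤ³ is ≈ 0.2302 < p_c (gen 6).  The weak inequality is the
theorem `pstarB3m_le_criticalProb`.  STRUCTURE CONJ C1b (prim-pcint-2 gens 11–14, 2026-08-22/23; STRUCTURE.md v0.5 §2/§5; not
kernel-checked). -/
@[conjecture] def saturationBelowCritical : Prop :=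
  ∀ d : ℕ, 3 ≤ d → ∃ η : ℝ, 0 < η ∧ ∀ (τ kc : ℕ) (p : unitInterval),
    p ∈ B3mCertSet d τ kc → (p : ℝ) + η ≤ criticalProb (zdGraph d) 0

/-- The conjecture in threshold form: under C1b, `p*_d(τ,kc) + η_d ≤ p_c^bond(ℤ^d)` uniformly (for `τ ≥ kc + 4`, `kc ≥ 2`, where
something is certifiable). [folklore] -/
theorem pstarB3m_add_le_of_saturationBelowCritical (h : saturationBelowCritical) {d : ℕ} (hd : 3 ≤ d) :
    ∃ η : ℝ, 0 < η ∧ ∀ τ kc : ℕ, kc + 4 ≤ τ → 2 ≤ kc → pstarB3m d τ kc + η ≤ criticalProb (zdGraph d) 0 := by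
  obtain ⟨η, hη, hall⟩ := h d hd
  refine ⟨η, hη, fun τ kc hτ hkc => ?_⟩
  have hne : {x : ℝ | ∃ p ∈ B3mCertSet d τ kc, (p : ℝ) = x}.Nonempty :=
    ⟨0, 0, zero_mem_B3mCertSet hτ hkc, rfl⟩
  have hle : ∀ x ∈ {x : ℝ | ∃ p ∈ B3mCertSet d τ kc, (p : ℝ) = x},
      x ≤ criticalProb (zdGraph d) 0 - η := by
    rintro x ⟨p, hp, rfl⟩
    linarith [hall τ kc p hp]
  have := csSup_le hne hle
  unfold pstarB3m
  linarith

end Summit.CriticalPhenomena.PercolationContinuityZ3.Theorems.Pcint.Saturation
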